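import Literature.Barriers.CriticalPhenomena.GridSAWCountingViaGridHamPath
import Literature.Computability.Complexity.CodeFPLists
import HarnessLib

/-!
# The codes of `GRIDHAMPATHCOUNT` instances in the algebra of typed polynomial time

Support for the machine half of `GridSAW.LOT2003_lemma4_gadgets` (Liśkiewicz–Ogihara–Toda 2003,
Lemma 4 with the embedding `E₀` of Theorem 7; assembly in `GridSAWLemma4OfLayout.lean`): a layout
function `lay : CNF ℕ → DrawnGraphInstance` has to be shown typed polynomial time on codes,
`CodeFP encodingCNF.encode encodingDrawnGraphInstance.encode lay` (`CodeFP.lean`). This file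
identifies the target code with the encoders of the `CodeFP` algebra and supplies the combinators a
layout program ends with:

* `gpE = pairE smE smE` is `encodingGridPoint.encode`, `deE` is `encodingDrawnEdge.encode`,
  `dgiE` is `encodingDrawnGraphInstance.encode` (`gpE_eq`, `deE_eq`, `dgiE_eq`);
* `CodeFP.gridPointOfNat` — the grid point `((x : ℤ), (y : ℤ))` of two naturals;
  `CodeFP.gridPointsOfNat` (a raw list of them), `CodeFP.drawnEdgeMk` (a drawn edge from its two
  end indices and its point list), `CodeFP.instanceMk` (an instance from its four components,
  converting raw lists to the length-headed lists of the code).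

## References

* M. Liśkiewicz, M. Ogihara, S. Toda, TCS 304 (2003) 129–156, §4 (proof of Theorem 7: the grid
  embedding is polynomial time).
* S. Arora, B. Barak, *Computational Complexity: A Modern Approach*, CUP 2009, §0.1 (codes of tuples
  and lists), §1.3.
-/

namespace Literature.Barriers.CriticalPhenomena.GridSAW

open _root_.Computability Literature.Computability.Complexity Literature.Computability.Complexity.CodeFP

/-! ### The encoders -/

/-- The code of a grid point: sign–magnitude integers, paired. [cite: AroraBarak2009, §0.1] -/
def gpE : GridPoint → List Bool := pairE smE smE

/-- The code of a drawn edge `(i, j, π)`. [cite: AroraBarak2009, §0.1] -/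
def deE : DrawnEdge → List Bool := pairE natE (pairE natE (listE gpE))

/-- The code of an instance `(P, D, s, t)`. [cite: AroraBarak2009, §0.1] -/
def dgiE : DrawnGraphInstance → List Bool := pairE (listE gpE) (pairE (listE deE) (pairE natE natE))

/-- `gpE` is `encodingGridPoint.encode`. [folklore] -/
theorem gpE_eq : (encodingGridPoint.encode : GridPoint → List Bool) = gpE := by
  unfold gpE encodingGridPoint
  rw [pairE_eq, smE]

/-- `deE` is `encodingDrawnEdge.encode`. [folklore] -/
theorem deE_eq : (encodingDrawnEdge.encode : DrawnEdge → List Bool) = deE := by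
  unfold deE encodingDrawnEdge
  rw [pairE_eq, pairE_eq, listE_eq, natE_eq, gpE_eq]

/-- `dgiE` is `encodingDrawnGraphInstance.encode`. [folklore] -/
theorem dgiE_eq : (encodingDrawnGraphInstance.encode : DrawnGraphInstance → List Bool) = dgiE := by
  unfold dgiE encodingDrawnGraphInstance
  rw [pairE_eq, pairE_eq, pairE_eq, listE_eq, listE_eq, natE_eq, gpE_eq, deE_eq]

/-- `gpE` is injective. [folklore] -/
theorem gpE_injective : Function.Injective gpE := by
  rw [← gpE_eq]; exact encodingGridPoint.encode_injective

/-! ### Combinators for layout programs -/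

namespace CodeFP

variable {α : Type} {eα : α → List Bool}

/-- **The grid point of two natural coordinates.** [cite: AroraBarak2009, §1.3] -/
theorem gridPointOfNat : CodeFP (pairE natE natE) gpE (fun p => ((p.1 : ℤ), (p.2 : ℤ))) :=
  ((smOfInt.comp (intOfNat.comp (fst natE natE))).pair (smOfInt.comp (intOfNat.comp (snd natE natE)))).congr
    fun _ => rfl

/-- A computed pair of naturals, as a grid point. [cite: AroraBarak2009, §1.3] -/
theorem gridPoint {x y : α → ℕ} (hx : CodeFP eα natE x) (hy : CodeFP eα natE y) :
    CodeFP eα gpE (fun a => ((x a : ℤ), (y a : ℤ))) :=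
  (gridPointOfNat.comp (hx.pair hy)).congr fun _ => rfl

/-- A raw list of pairs of naturals, as a raw list of grid points. [cite: AroraBarak2009, §1.3] -/
theorem gridPointsOfNat : CodeFP (rawE (pairE natE natE)) (rawE gpE) (fun l => l.map fun p => ((p.1 : ℤ), (p.2 : ℤ))) :=
  map₀ gridPointOfNat

/-- **A drawn edge** from its end indices and its (raw) point list. [cite: AroraBarak2009, §1.3] -/
theorem drawnEdgeMk {i j : α → ℕ} {π : α → List GridPoint} (hi : CodeFP eα natE i) (hj : CodeFP eα natE j)
    (hπ : CodeFP eα (rawE gpE) π) : CodeFP eα deE (fun a => ((i a, j a, π a) : DrawnEdge)) :=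
  (hi.pair (hj.pair ((listOfRaw gpE).comp hπ))).congr fun _ => rfl

/-- **An instance** from its vertex images (raw), drawn edges (raw) and end vertices.
[cite: AroraBarak2009, §1.3] -/
theorem instanceMk {P : α → List GridPoint} {D : α → List DrawnEdge} {s t : α → ℕ} (hP : CodeFP eα (rawE gpE) P)
    (hD : CodeFP eα (rawE deE) D) (hs : CodeFP eα natE s) (ht : CodeFP eα natE t) :
    CodeFP eα dgiE (fun a => ((P a, D a, s a, t a) : DrawnGraphInstance)) :=
  (((listOfRaw gpE).comp hP).pair (((listOfRaw deE).comp hD).pair (hs.pair ht))).congr fun _ => rfl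

/-- The same with the tree's encoding as target. [cite: AroraBarak2009, §1.3] -/
theorem instanceMk' {P : α → List GridPoint} {D : α → List DrawnEdge} {s t : α → ℕ} (hP : CodeFP eα (rawE gpE) P)
    (hD : CodeFP eα (rawE deE) D) (hs : CodeFP eα natE s) (ht : CodeFP eα natE t) :
    CodeFP eα (encodingDrawnGraphInstance.encode : DrawnGraphInstance → List Bool)
      (fun a => ((P a, D a, s a, t a) : DrawnGraphInstance)) := by
  rw [dgiE_eq]; exact instanceMk hP hD hs ht

/-- **A horizontal or vertical unit-step segment** as a point list: the points
`(x₀ + i·dx, y₀ + i·dy)` for `i < n`, from natural parameters (`n` bounded by a unary budget `u`).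
[cite: LiskiewiczOgiharaToda2003, §4 ("the paths which realize the edges in the two-dimensional grid")] -/
theorem segmentOfNat :
    CodeFP (pairE unE (pairE natE (pairE natE (pairE natE (pairE natE natE)))))
      (rawE gpE)
      (fun p => (List.range (min p.2.1 p.1)).map fun i =>
        (((p.2.2.1 + i * p.2.2.2.2.1 : ℕ) : ℤ), ((p.2.2.2.1 + i * p.2.2.2.2.2 : ℕ) : ℤ))) := by
  -- context: (x₀, dx, y₀, dy); items: i
  have hr : CodeFP (pairE unE (pairE natE (pairE natE (pairE natE (pairE natE natE))))) (rawE natE)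
      (fun p => List.range (min p.2.1 p.1)) := rangeOf.comp ((fst _ _).pair (snd _ _).fst')
  set eσ := pairE unE (pairE natE (pairE natE (pairE natE (pairE natE natE)))) with heσ
  have hx₀ : CodeFP (pairE eσ natE) natE (fun q => q.1.2.2.1) := (fst _ _).snd'.snd'.fst'
  have hy₀ : CodeFP (pairE eσ natE) natE (fun q => q.1.2.2.2.1) := (fst _ _).snd'.snd'.snd'.fst'
  have hdx : CodeFP (pairE eσ natE) natE (fun q => q.1.2.2.2.2.1) := (fst _ _).snd'.snd'.snd'.snd'.fst'
  have hdy : CodeFP (pairE eσ natE) natE (fun q => q.1.2.2.2.2.2) := (fst _ _).snd'.snd'.snd'.snd'.snd'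
  have hi : CodeFP (pairE eσ natE) natE (fun q => q.2) := snd _ _
  have hx : CodeFP (pairE eσ natE) natE (fun q => q.1.2.2.1 + q.2 * q.1.2.2.2.2.1) :=
    (natAdd.comp (hx₀.pair (natMul.comp (hi.pair hdx)))).congr fun _ => rfl
  have hy : CodeFP (pairE eσ natE) natE (fun q => q.1.2.2.2.1 + q.2 * q.1.2.2.2.2.2) :=
    (natAdd.comp (hy₀.pair (natMul.comp (hi.pair hdy)))).congr fun _ => rfl
  have hitem := gridPoint hx hy
  exact ((map (σ := ℕ × ℕ × ℕ × ℕ × ℕ × ℕ) (eσ := eσ) hitem).comp ((CodeFP.id eσ).pair hr)).congr fun _ => rfl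

end CodeFP

end Literature.Barriers.CriticalPhenomena.GridSAW
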